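import Summits.KontsevichZagierPeriods.KontsevichZagierPeriods.Theorems.LogKernelConjecture.Negative.LoadBearing
import Literature.NumberTheory.Transcendental.KZLogCalculusProofs

/-!
# `LogKernelConjecture` (stmt-KontsevichZagierPeriods-2837) — negative knowledge, part 4: clause census of the rule

The closure hypothesis of the crux (and the sibling crux `LogPrimitiveNL`, stmt-2836, which is the
same binder block with conclusion `∈ KZ.relations`) quantifies over instances of a logarithmic
Newton–Leibniz rule with twelve clauses.  Part 2 showed that deleting `a ≤ b` forces `R = ⊤`.  Here:

* §10 deleting any ONE of `hdom` (band equation), `hr'` (base integrand), `hr` (band integrand) or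
  `hder` (fibrewise derivative) likewise forces `R = ⊤`
  (`eq_top_of_closedUnderLogNLWithout{Dom,Base,Band,Deriv}`), so all five structurally mutated
  cruxes are trivially TRUE (`structural_clause_variants_hold`) — these clauses are vacuity guards;
* (part 5, `Negative/Continuity.lean`) deleting `hcont` makes the rule UNSOUND instead.
The remaining clauses (`0 < Vᵢ`, termwise integrability, `ℚ`-semialgebraicity of `a, b, hᵢ, Vᵢ`)
are not used by the soundness proof of part 1 (`eval_eq_zero_of_mem_logNLInstances`).
[cite: KontsevichZagierPeriods2001, §1.2 rule (3)]
-/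

noncomputable section

open MeasureTheory Set
open Literature.NumberTheory.Transcendental

namespace Summit.KontsevichZagierPeriods.LiouvilleUnfolding.LogKernelConjectureNegative

open Summit.KontsevichZagierPeriods.KontsevichZagierPeriods.Theses.LiouvilleUnfolding
  (LogKernelConjecture LogPrimitiveNL)

/-! ## §10 Clause census of the logarithmic rule: four more vacuity guards

Besides `a ≤ b` (§6), deleting any ONE of the clauses `hdom` (the band equation), `hr` (the band
integrand), `hr'` (the base integrand) or `hder` (the fibrewise derivative) from the rule makes EVERY
generator a member of `R`, hence `R = ⊤` and the correspondingly mutated crux trivially true. -/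

/-- The zero representation on a `ℚ`-semialgebraic set (domain definitionally `σ`). [folklore] -/
def zeroRep {n : ℕ} (σ : Set (Fin n → ℝ))
    (hσ : Literature.ModelTheory.ExponentialFields.IsSemialgebraic ℚ σ) : KZ.IntegralRep n :=
  ⟨σ, 0, hσ, (isSemialgebraicFunOn_aeval hσ 0).congr fun x _ => by simp, integrableOn_zero⟩

/-- `[σ, 0]` is a relation. [folklore] -/
theorem of_zeroRep_mem_relations {n : ℕ} (σ : Set (Fin n → ℝ))
    (hσ : Literature.ModelTheory.ExponentialFields.IsSemialgebraic ℚ σ) :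
    KZ.of (zeroRep σ hσ) ∈ KZ.relations :=
  KZ.of_mem_relations_of_eqOn_zero _ fun _ _ => rfl

/-- If every generator lies in `R` then `R = ⊤`. [folklore] -/
theorem eq_top_of_forall_of_mem {R : AddSubgroup KZ.FormalRep}
    (h : ∀ (n : ℕ) (r : KZ.IntegralRep n), KZ.of r ∈ R) : R = ⊤ := by
  have hall : ∀ c : KZ.FormalRep, c ∈ R := fun c => by
    induction c using FreeAbelianGroup.induction_on with
    | zero => exact R.zero_mem
    | of p => exact h p.1 p.2
    | neg p hp => exact R.neg_mem hp
    | add x y hx hy => exact R.add_mem hx hy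
  exact eq_top_iff.2 fun c _ => hall c

/-- If every generator of POSITIVE dimension lies in `R ⊇ relations` then `R = ⊤` (dimension `0`
generators are slabs minus one Newton–Leibniz move, `KZ.IntegralRep.of_slab_sub_of_mem_newtonLeibnizRel`).
[folklore] -/
theorem eq_top_of_forall_succ_of_mem {R : AddSubgroup KZ.FormalRep} (hrel : KZ.relations ≤ R)
    (h : ∀ (n : ℕ) (r : KZ.IntegralRep (n + 1)), KZ.of r ∈ R) : R = ⊤ := by
  refine eq_top_of_forall_of_mem fun n => ?_
  cases n with
  | zero =>
    intro r
    have h1 : KZ.of (r.slab 0) ∈ R := h 0 (r.slab 0)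
    have h2 : KZ.of (r.slab 0) - KZ.of r ∈ R :=
      hrel (KZ.newtonLeibnizRel_subset_relations (r.of_slab_sub_of_mem_newtonLeibnizRel 0))
    simpa using R.sub_mem h1 h2
  | succ n => exact h n

/-- The mutated crux is trivially true as soon as its closure hypothesis forces `R = ⊤`. [folklore] -/
theorem variant_holds_of_eq_top {C : AddSubgroup KZ.FormalRep → Prop}
    (hC : ∀ R, KZ.relations ≤ R → C R → R = ⊤) :
    ∀ R : AddSubgroup KZ.FormalRep, KZ.relations ≤ R → C R →
      ∀ c : KZ.FormalRep, KZ.eval c = 0 → c ∈ R := by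
  intro R hrel hR c _
  rw [hC R hrel hR]
  exact AddSubgroup.mem_top c

/-- The closure hypothesis with the band equation `hdom` DELETED. [folklore] -/
def ClosedUnderLogNLWithoutDom (R : AddSubgroup KZ.FormalRep) : Prop :=
  ∀ (n k : ℕ) (r : KZ.IntegralRep (n + 1)) (r' : KZ.IntegralRep n) (a b : (Fin n → ℝ) → ℝ)
    (h : Fin k → (Fin n → ℝ) → ℝ) (V V' : Fin k → (Fin (n + 1) → ℝ) → ℝ),
    IsSemialgebraicFunOn ℚ r'.domain a → IsSemialgebraicFunOn ℚ r'.domain b →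
    (∀ x ∈ r'.domain, a x ≤ b x) →
    (∀ i, IsSemialgebraicFunOn ℚ r'.domain (h i)) →
    (∀ i, IsSemialgebraicFunOn ℚ r.domain (V i)) →
    (∀ i, ∀ z ∈ r.domain, 0 < V i z) →
    (∀ i, ∀ x ∈ r'.domain, ContinuousOn (fun t : ℝ => V i (Fin.snoc x t)) (Set.Icc (a x) (b x))) →
    (∀ i, ∀ x ∈ r'.domain, ∀ t ∈ Set.Ioo (a x) (b x),
      HasDerivAt (fun s : ℝ => V i (Fin.snoc x s)) (V' i (Fin.snoc x t)) t) →
    (∀ i, IntegrableOn (fun z => h i (Fin.init z) * V' i z / V i z) r.domain) →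
    (∀ x ∈ r'.domain, ∀ t ∈ Set.Ioo (a x) (b x),
      r.integrand (Fin.snoc x t) = ∑ i, h i x * V' i (Fin.snoc x t) / V i (Fin.snoc x t)) →
    (∀ x ∈ r'.domain, r'.integrand x =
      ∑ i, h i x * (Real.log (V i (Fin.snoc x (b x))) - Real.log (V i (Fin.snoc x (a x))))) →
    KZ.of r - KZ.of r' ∈ R

/-- **`hdom` is a vacuity guard**: without the band equation, `r` is free; with `k = 0`,
`a = b = 0`, `r' = [ℝⁿ, 0]` every analytic clause is vacuous and the instance reads
`[r] − [ℝⁿ, 0] ∈ R` for EVERY `r` of positive dimension. [folklore] -/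
theorem eq_top_of_closedUnderLogNLWithoutDom {R : AddSubgroup KZ.FormalRep} (hrel : KZ.relations ≤ R)
    (hR : ClosedUnderLogNLWithoutDom R) : R = ⊤ := by
  refine eq_top_of_forall_succ_of_mem hrel fun n r => ?_
  have hu := Literature.ModelTheory.ExponentialFields.isSemialgebraic_univ (k := ℚ) (R := ℝ)
    (ι := Fin n)
  have h0 : IsSemialgebraicFunOn ℚ (Set.univ : Set (Fin n → ℝ)) (fun _ => (0 : ℝ)) := by
    simpa using isSemialgebraicFunOn_natCast hu 0
  have key := hR n 0 r (zeroRep Set.univ hu) (fun _ => 0) (fun _ => 0) Fin.elim0 Fin.elim0 Fin.elim0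
    h0 h0 (fun _ _ => le_rfl) (fun i => i.elim0) (fun i => i.elim0) (fun i => i.elim0)
    (fun i => i.elim0) (fun i => i.elim0) (fun i => i.elim0)
    (fun x _ t ht => absurd ht (by simp)) (fun x _ => by simp [zeroRep])
  have hz : KZ.of (zeroRep (Set.univ : Set (Fin n → ℝ)) hu) ∈ R := hrel (of_zeroRep_mem_relations _ _)
  simpa using R.add_mem key hz

/-- The closure hypothesis with the base-integrand clause `hr'` DELETED. [folklore] -/
def ClosedUnderLogNLWithoutBase (R : AddSubgroup KZ.FormalRep) : Prop :=
  ∀ (n k : ℕ) (r : KZ.IntegralRep (n + 1)) (r' : KZ.IntegralRep n) (a b : (Fin n → ℝ) → ℝ)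
    (h : Fin k → (Fin n → ℝ) → ℝ) (V V' : Fin k → (Fin (n + 1) → ℝ) → ℝ),
    IsSemialgebraicFunOn ℚ r'.domain a → IsSemialgebraicFunOn ℚ r'.domain b →
    (∀ x ∈ r'.domain, a x ≤ b x) →
    r.domain = {z | (Fin.init z : Fin n → ℝ) ∈ r'.domain ∧ a (Fin.init z) ≤ z (Fin.last n) ∧
      z (Fin.last n) ≤ b (Fin.init z)} →
    (∀ i, IsSemialgebraicFunOn ℚ r'.domain (h i)) →
    (∀ i, IsSemialgebraicFunOn ℚ r.domain (V i)) →
    (∀ i, ∀ z ∈ r.domain, 0 < V i z) →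
    (∀ i, ∀ x ∈ r'.domain, ContinuousOn (fun t : ℝ => V i (Fin.snoc x t)) (Set.Icc (a x) (b x))) →
    (∀ i, ∀ x ∈ r'.domain, ∀ t ∈ Set.Ioo (a x) (b x),
      HasDerivAt (fun s : ℝ => V i (Fin.snoc x s)) (V' i (Fin.snoc x t)) t) →
    (∀ i, IntegrableOn (fun z => h i (Fin.init z) * V' i z / V i z) r.domain) →
    (∀ x ∈ r'.domain, ∀ t ∈ Set.Ioo (a x) (b x),
      r.integrand (Fin.snoc x t) = ∑ i, h i x * V' i (Fin.snoc x t) / V i (Fin.snoc x t)) →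
    KZ.of r - KZ.of r' ∈ R

/-- **`hr'` is a vacuity guard**: without the base-integrand clause, `r'` is free; with `k = 0`
and `r = [slab over r'.domain, 0]` the instance reads `[slab, 0] − [r'] ∈ R` for EVERY `r'`.
[folklore] -/
theorem eq_top_of_closedUnderLogNLWithoutBase {R : AddSubgroup KZ.FormalRep}
    (hrel : KZ.relations ≤ R) (hR : ClosedUnderLogNLWithoutBase R) : R = ⊤ := by
  refine eq_top_of_forall_of_mem fun n s => ?_
  have h0 : IsSemialgebraicFunOn ℚ s.domain (fun _ => ((0 : ℕ) : ℝ)) :=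
    isSemialgebraicFunOn_natCast s.isSemialgebraic_domain 0
  have h1 : IsSemialgebraicFunOn ℚ s.domain (fun _ => ((0 : ℕ) : ℝ) + 1) :=
    (isSemialgebraicFunOn_aeval s.isSemialgebraic_domain
      (((0 : ℕ) : MvPolynomial (Fin n) ℚ) + 1)).congr fun x _ => by simp
  have key := hR n 0 (zeroRep (s.slabDomain 0) (s.isSemialgebraic_slabDomain 0)) s
    (fun _ => ((0 : ℕ) : ℝ)) (fun _ => ((0 : ℕ) : ℝ) + 1) Fin.elim0 Fin.elim0 Fin.elim0 h0 h1
    (fun _ _ => by simp) rfl (fun i => i.elim0) (fun i => i.elim0) (fun i => i.elim0)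
    (fun i => i.elim0) (fun i => i.elim0) (fun i => i.elim0) (fun x _ t _ => by simp [zeroRep])
  have hz : KZ.of (zeroRep (s.slabDomain 0) (s.isSemialgebraic_slabDomain 0)) ∈ R :=
    hrel (of_zeroRep_mem_relations _ _)
  simpa using R.sub_mem hz key

/-- The closure hypothesis with the band-integrand clause `hr` DELETED. [folklore] -/
def ClosedUnderLogNLWithoutBand (R : AddSubgroup KZ.FormalRep) : Prop :=
  ∀ (n k : ℕ) (r : KZ.IntegralRep (n + 1)) (r' : KZ.IntegralRep n) (a b : (Fin n → ℝ) → ℝ)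
    (h : Fin k → (Fin n → ℝ) → ℝ) (V V' : Fin k → (Fin (n + 1) → ℝ) → ℝ),
    IsSemialgebraicFunOn ℚ r'.domain a → IsSemialgebraicFunOn ℚ r'.domain b →
    (∀ x ∈ r'.domain, a x ≤ b x) →
    r.domain = {z | (Fin.init z : Fin n → ℝ) ∈ r'.domain ∧ a (Fin.init z) ≤ z (Fin.last n) ∧
      z (Fin.last n) ≤ b (Fin.init z)} →
    (∀ i, IsSemialgebraicFunOn ℚ r'.domain (h i)) →
    (∀ i, IsSemialgebraicFunOn ℚ r.domain (V i)) →
    (∀ i, ∀ z ∈ r.domain, 0 < V i z) →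
    (∀ i, ∀ x ∈ r'.domain, ContinuousOn (fun t : ℝ => V i (Fin.snoc x t)) (Set.Icc (a x) (b x))) →
    (∀ i, ∀ x ∈ r'.domain, ∀ t ∈ Set.Ioo (a x) (b x),
      HasDerivAt (fun s : ℝ => V i (Fin.snoc x s)) (V' i (Fin.snoc x t)) t) →
    (∀ i, IntegrableOn (fun z => h i (Fin.init z) * V' i z / V i z) r.domain) →
    (∀ x ∈ r'.domain, r'.integrand x =
      ∑ i, h i x * (Real.log (V i (Fin.snoc x (b x))) - Real.log (V i (Fin.snoc x (a x))))) →
    KZ.of r - KZ.of r' ∈ R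

/-- **`hr` is a vacuity guard**: without the band-integrand clause, `r` is any representation on
the band; with `k = 0`, `r = slab s`, `r' = [s.domain, 0]` the instance gives `[slab s] ∈ R`, and
`[slab s] − [s]` is one Newton–Leibniz move. [folklore] -/
theorem eq_top_of_closedUnderLogNLWithoutBand {R : AddSubgroup KZ.FormalRep}
    (hrel : KZ.relations ≤ R) (hR : ClosedUnderLogNLWithoutBand R) : R = ⊤ := by
  refine eq_top_of_forall_of_mem fun n s => ?_
  have h0 : IsSemialgebraicFunOn ℚ s.domain (fun _ => ((0 : ℕ) : ℝ)) :=
    isSemialgebraicFunOn_natCast s.isSemialgebraic_domain 0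
  have h1 : IsSemialgebraicFunOn ℚ s.domain (fun _ => ((0 : ℕ) : ℝ) + 1) :=
    (isSemialgebraicFunOn_aeval s.isSemialgebraic_domain
      (((0 : ℕ) : MvPolynomial (Fin n) ℚ) + 1)).congr fun x _ => by simp
  have key := hR n 0 (s.slab 0) (zeroRep s.domain s.isSemialgebraic_domain)
    (fun _ => ((0 : ℕ) : ℝ)) (fun _ => ((0 : ℕ) : ℝ) + 1) Fin.elim0 Fin.elim0 Fin.elim0 h0 h1
    (fun _ _ => by simp) rfl (fun i => i.elim0) (fun i => i.elim0) (fun i => i.elim0)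
    (fun i => i.elim0) (fun i => i.elim0) (fun i => i.elim0) (fun x _ => by simp [zeroRep])
  have hz : KZ.of (zeroRep s.domain s.isSemialgebraic_domain) ∈ R :=
    hrel (of_zeroRep_mem_relations _ _)
  have hslab : KZ.of (s.slab 0) ∈ R := by simpa using R.add_mem key hz
  have hnl : KZ.of (s.slab 0) - KZ.of s ∈ R :=
    hrel (KZ.newtonLeibnizRel_subset_relations (s.of_slab_sub_of_mem_newtonLeibnizRel 0))
  simpa using R.sub_mem hslab hnl

/-- The closure hypothesis with the fibrewise-derivative clause `hder` DELETED. [folklore] -/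
def ClosedUnderLogNLWithoutDeriv (R : AddSubgroup KZ.FormalRep) : Prop :=
  ∀ (n k : ℕ) (r : KZ.IntegralRep (n + 1)) (r' : KZ.IntegralRep n) (a b : (Fin n → ℝ) → ℝ)
    (h : Fin k → (Fin n → ℝ) → ℝ) (V V' : Fin k → (Fin (n + 1) → ℝ) → ℝ),
    IsSemialgebraicFunOn ℚ r'.domain a → IsSemialgebraicFunOn ℚ r'.domain b →
    (∀ x ∈ r'.domain, a x ≤ b x) →
    r.domain = {z | (Fin.init z : Fin n → ℝ) ∈ r'.domain ∧ a (Fin.init z) ≤ z (Fin.last n) ∧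
      z (Fin.last n) ≤ b (Fin.init z)} →
    (∀ i, IsSemialgebraicFunOn ℚ r'.domain (h i)) →
    (∀ i, IsSemialgebraicFunOn ℚ r.domain (V i)) →
    (∀ i, ∀ z ∈ r.domain, 0 < V i z) →
    (∀ i, ∀ x ∈ r'.domain, ContinuousOn (fun t : ℝ => V i (Fin.snoc x t)) (Set.Icc (a x) (b x))) →
    (∀ i, IntegrableOn (fun z => h i (Fin.init z) * V' i z / V i z) r.domain) →
    (∀ x ∈ r'.domain, ∀ t ∈ Set.Ioo (a x) (b x),
      r.integrand (Fin.snoc x t) = ∑ i, h i x * V' i (Fin.snoc x t) / V i (Fin.snoc x t)) →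
    (∀ x ∈ r'.domain, r'.integrand x =
      ∑ i, h i x * (Real.log (V i (Fin.snoc x (b x))) - Real.log (V i (Fin.snoc x (a x))))) →
    KZ.of r - KZ.of r' ∈ R

/-- **`hder` is a vacuity guard**: without the derivative clause, `V'` is free; with `k = 1`,
`h = 1`, `V = 1`, `V' = f ∘ init` (a bogus "derivative" of the constant `1`) and `r = slab s`,
`r' = [s.domain, 0]` (`log 1 − log 1 = 0`), the instance gives `[slab s] ∈ R`. [folklore] -/
theorem eq_top_of_closedUnderLogNLWithoutDeriv {R : AddSubgroup KZ.FormalRep}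
    (hrel : KZ.relations ≤ R) (hR : ClosedUnderLogNLWithoutDeriv R) : R = ⊤ := by
  refine eq_top_of_forall_of_mem fun n s => ?_
  have h0 : IsSemialgebraicFunOn ℚ s.domain (fun _ => ((0 : ℕ) : ℝ)) :=
    isSemialgebraicFunOn_natCast s.isSemialgebraic_domain 0
  have h1 : IsSemialgebraicFunOn ℚ s.domain (fun _ => ((0 : ℕ) : ℝ) + 1) :=
    (isSemialgebraicFunOn_aeval s.isSemialgebraic_domain
      (((0 : ℕ) : MvPolynomial (Fin n) ℚ) + 1)).congr fun x _ => by simp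
  have hone : IsSemialgebraicFunOn ℚ s.domain (fun _ => (1 : ℝ)) := by
    simpa using isSemialgebraicFunOn_natCast s.isSemialgebraic_domain 1
  have hone' : IsSemialgebraicFunOn ℚ (s.slab 0).domain (fun _ => (1 : ℝ)) := by
    simpa using isSemialgebraicFunOn_natCast (s.slab 0).isSemialgebraic_domain 1
  have key := hR n 1 (s.slab 0) (zeroRep s.domain s.isSemialgebraic_domain)
    (fun _ => ((0 : ℕ) : ℝ)) (fun _ => ((0 : ℕ) : ℝ) + 1) (fun _ _ => 1) (fun _ _ => 1)
    (fun _ z => s.integrand (Fin.init z)) h0 h1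
    (fun _ _ => by simp) rfl (fun _ => hone) (fun _ => hone') (fun _ _ _ => one_pos)
    (fun _ x _ => continuousOn_const) (fun _ => by simpa using (s.slab 0).integrableOn)
    (fun x _ t _ => by simp) (fun x _ => by simp [zeroRep])
  have hz : KZ.of (zeroRep s.domain s.isSemialgebraic_domain) ∈ R :=
    hrel (of_zeroRep_mem_relations _ _)
  have hslab : KZ.of (s.slab 0) ∈ R := by simpa using R.add_mem key hz
  have hnl : KZ.of (s.slab 0) - KZ.of s ∈ R :=
    hrel (KZ.newtonLeibnizRel_subset_relations (s.of_slab_sub_of_mem_newtonLeibnizRel 0))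
  simpa using R.sub_mem hslab hnl

/-- **Census**: each of the five mutated cruxes (one structural clause of the rule deleted) is
trivially TRUE. [folklore] -/
theorem structural_clause_variants_hold :
    (∀ R : AddSubgroup KZ.FormalRep, KZ.relations ≤ R → ClosedUnderLogNLWithoutLe R →
      ∀ c : KZ.FormalRep, KZ.eval c = 0 → c ∈ R) ∧
    (∀ R : AddSubgroup KZ.FormalRep, KZ.relations ≤ R → ClosedUnderLogNLWithoutDom R →
      ∀ c : KZ.FormalRep, KZ.eval c = 0 → c ∈ R) ∧
    (∀ R : AddSubgroup KZ.FormalRep, KZ.relations ≤ R → ClosedUnderLogNLWithoutBase R →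
      ∀ c : KZ.FormalRep, KZ.eval c = 0 → c ∈ R) ∧
    (∀ R : AddSubgroup KZ.FormalRep, KZ.relations ≤ R → ClosedUnderLogNLWithoutBand R →
      ∀ c : KZ.FormalRep, KZ.eval c = 0 → c ∈ R) ∧
    (∀ R : AddSubgroup KZ.FormalRep, KZ.relations ≤ R → ClosedUnderLogNLWithoutDeriv R →
      ∀ c : KZ.FormalRep, KZ.eval c = 0 → c ∈ R) :=
  ⟨variant_holds_of_eq_top fun _ => eq_top_of_closedUnderLogNLWithoutLe,
    variant_holds_of_eq_top fun _ => eq_top_of_closedUnderLogNLWithoutDom,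
    variant_holds_of_eq_top fun _ => eq_top_of_closedUnderLogNLWithoutBase,
    variant_holds_of_eq_top fun _ => eq_top_of_closedUnderLogNLWithoutBand,
    variant_holds_of_eq_top fun _ => eq_top_of_closedUnderLogNLWithoutDeriv⟩


end Summit.KontsevichZagierPeriods.LiouvilleUnfolding.LogKernelConjectureNegative
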